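import Mathlib
import HarnessLib
import Summits.KontsevichZagierPeriods.Statement
import Literature.NumberTheory.Transcendental.KZProductIdeal
import Literature.NumberTheory.Transcendental.KZKernelConjectureForms
import Literature.NumberTheory.Transcendental.KZCubeRationalMoves
import Literature.NumberTheory.Transcendental.KZLogCalculusProofs

/-!
# Census pair #22 (the ℚ(√−3) pair 4·[□²,1/(3−2N)] ≡ 5·[□²,1/(3−N)], N = u²−uv+v²) and #0 DECIDED in `KZ.relations` by rules 1+2 (route `RootDecompQuadraticDescent`, instances of crux stmt-KontsevichZagierPeriods-28994 / stmt-4280) · part 1/7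

Cell `decomp-kz`, lens 6 (decomp-kz-lens-6 g7): `pair22 : 4•[□²,1/(1+2x+2y−2x²+2xy−2y²)] − 5•[□²,1/(2+x+y−x²+xy−y²)] ∈ KZ.relations` (values (5/8)·L(2,χ₋₃), L(2,χ₋₃)/2): reflections → diagonal cut + fold → BLOW-UP (u,k) ↦ (u,uk) via `KZ.of_sub_of_mem_relations_of_affine` → fibre substitution into a LOG BAND over q(u) = 1−u+u² → 23 band relations incl. SEVEN ℚ-rational base substitutions (dihedral symmetries + angle doublings of the Eisenstein conic) + one ℤ-identity; NO Stokes; `pair0` by ONE Möbius substitution y = x/(2−x); packaged `pairs_decided`, `pairs_descentTwoQ_instances`, `pairs_of_kzDimTwo` BY NAME.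

Source: `HOME/decomp-kz-lens-6/g7/EisensteinPair22.lean` sha256 fdb5e0bbc5a4a341 (1894 l; critic decomp-kz-crit-1 g2 CLEARED 2026-08-30T07:59:44Z, std axioms), split into 7 modules by the landing seat decomp-kz-census-1 g7 (contexts re-opened per part; generic docstrings added where the source had none; the route file is imported only by the last part, which proves the `KZDimTwo` corollaries BY NAME).  No `sorry`; standard axioms.  References: [cite: KontsevichZagier2001, §1.2].
-/

noncomputable section

open MeasureTheory Set MvPolynomial

namespace Summit.KontsevichZagierPeriods.RootDecompQuadraticDescent.EisensteinPair

open Literature.NumberTheory.Transcendental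
open Literature.NumberTheory.Transcendental.KZ
open Literature.ModelTheory.ExponentialFields (IsSemialgebraic)

/-! ## Small `Fin` bookkeeping -/

/-- `snoc2_zero`: auxiliary theorem of the lens-6 development «eis» (instances of 28994/4280) — see the module docstring; verbatim from the lens file. -/
@[simp] private theorem snoc2_zero (x : Fin 1 → ℝ) (t : ℝ) : (Fin.snoc x t : Fin 2 → ℝ) 0 = x 0 := rfl
/-- `snoc2_one`: auxiliary theorem of the lens-6 development «eis» (instances of 28994/4280) — see the module docstring; verbatim from the lens file. -/
@[simp] private theorem snoc2_one (x : Fin 1 → ℝ) (t : ℝ) : (Fin.snoc x t : Fin 2 → ℝ) 1 = t := rfl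
/-- `init2_zero`: auxiliary theorem of the lens-6 development «eis» (instances of 28994/4280) — see the module docstring; verbatim from the lens file. -/
@[simp] private theorem init2_zero (z : Fin 2 → ℝ) : Fin.init z 0 = z 0 := rfl
/-- `last_one_eq`: auxiliary theorem of the lens-6 development «eis» (instances of 28994/4280) — see the module docstring; verbatim from the lens file. -/
private theorem last_one_eq : (Fin.last 1 : Fin 2) = 1 := rfl
/-- `fin1_eq`: auxiliary theorem of the lens-6 development «eis» (instances of 28994/4280) — see the module docstring; verbatim from the lens file. -/
private theorem fin1_eq (y : Fin 1 → ℝ) : y = fun _ => y 0 := funext fun i => by rw [Fin.fin_one_eq_zero i]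

/-! ## The Eisenstein norm form `q(t) = 1 − t + t²` and log-band representations over intervals -/

/-- `q(t) = 1 − t + t² = |1 + t ζ₃|²`. -/
def qf (t : ℝ) : ℝ := 1 - t + t ^ 2

/-- `qf_pos`: auxiliary theorem of the lens-6 development «eis» (instances of 28994/4280) — see the module docstring; verbatim from the lens file. -/
theorem qf_pos (t : ℝ) : 0 < qf t := by unfold qf; nlinarith [sq_nonneg (t - 1/2)]
/-- `qf_ge`: auxiliary theorem of the lens-6 development «eis» (instances of 28994/4280) — see the module docstring; verbatim from the lens file. -/
private theorem qf_ge (t : ℝ) : 3 / 4 ≤ qf t := by unfold qf; nlinarith [sq_nonneg (t - 1/2)]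

/-- The interval `[a, b]` as a subset of `ℝ¹`. -/
def ivl (a b : ℚ) : Set (Fin 1 → ℝ) := {y | (a : ℝ) ≤ y 0 ∧ y 0 ≤ b}

/-- `mem_ivl`: auxiliary theorem of the lens-6 development «eis» (instances of 28994/4280) — see the module docstring; verbatim from the lens file. -/
theorem mem_ivl {a b : ℚ} {y : Fin 1 → ℝ} : y ∈ ivl a b ↔ (a : ℝ) ≤ y 0 ∧ y 0 ≤ b := Iff.rfl

/-- `isSemialgebraic_ivl`: auxiliary theorem of the lens-6 development «eis» (instances of 28994/4280) — see the module docstring; verbatim from the lens file. -/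
theorem isSemialgebraic_ivl (a b : ℚ) : IsSemialgebraic ℚ (ivl a b) := by
  have h1 := Literature.ModelTheory.ExponentialFields.isSemialgebraic_setOf_eval_le (k := ℚ) (R := ℝ)
    (C a : MvPolynomial (Fin 1) ℚ) (X 0)
  have h2 := Literature.ModelTheory.ExponentialFields.isSemialgebraic_setOf_eval_le (k := ℚ) (R := ℝ)
    (X 0 : MvPolynomial (Fin 1) ℚ) (C b)
  have h := h1.inter h2
  simp only [MvPolynomial.aeval_C, MvPolynomial.aeval_X, eq_ratCast] at h
  have hset : ivl a b = {y : Fin 1 → ℝ | (a : ℝ) ≤ y 0} ∩ {y | y 0 ≤ (b : ℝ)} := by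
    ext y; simp [ivl]
  rw [hset]
  exact h

/-- `ivl_eq_Icc`: auxiliary theorem of the lens-6 development «eis» (instances of 28994/4280) — see the module docstring; verbatim from the lens file. -/
private theorem ivl_eq_Icc (a b : ℚ) : ivl a b = Icc (fun _ => (a : ℝ)) (fun _ => (b : ℝ)) := by
  ext y
  simp only [ivl, mem_setOf_eq, mem_Icc, Pi.le_def, Fin.forall_fin_one]

/-- `isCompact_ivl`: auxiliary theorem of the lens-6 development «eis» (instances of 28994/4280) — see the module docstring; verbatim from the lens file. -/
private theorem isCompact_ivl (a b : ℚ) : IsCompact (ivl a b) := by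
  rw [ivl_eq_Icc]; exact isCompact_Icc

/-- `y ↦ c / q(y₀)` is `ℚ`-semialgebraic on any semialgebraic subset of `ℝ¹`. -/
theorem isSemialgebraicFunOn_cq {s : Set (Fin 1 → ℝ)} (hs : IsSemialgebraic ℚ s) (c : ℚ) :
    IsSemialgebraicFunOn ℚ s (fun y => (c : ℝ) / qf (y 0)) := by
  refine (isSemialgebraicFunOn_aeval_div_aeval hs (C c) (1 - X 0 + X 0 ^ 2) fun y _ => ?_).congr
    fun y _ => ?_
  · have := qf_pos (y 0)
    simp only [map_add, map_sub, map_one, map_pow, aeval_X, qf] at this ⊢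
    exact this.ne'
  · simp [qf]

/-- The data of a logarithmic argument `v ≥ 1` over `[a, b]`. -/
structure LogArg (a b : ℚ) where
  v : ℝ → ℝ
  sa : IsSemialgebraicFunOn ℚ (ivl a b) (fun y => v (y 0))
  one_le : ∀ t ∈ Icc (a : ℝ) b, 1 ≤ v t
  cont : ContinuousOn v (Icc (a : ℝ) b)

namespace LogArg

variable {a b : ℚ}

/-- `pos`: auxiliary theorem of the lens-6 development «eis» (instances of 28994/4280) — see the module docstring; verbatim from the lens file. -/
private theorem pos (V : LogArg a b) {t : ℝ} (ht : t ∈ Icc (a : ℝ) b) : 0 < V.v t :=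
  lt_of_lt_of_le one_pos (V.one_le t ht)

/-- `exists_bound`: auxiliary theorem of the lens-6 development «eis» (instances of 28994/4280) — see the module docstring; verbatim from the lens file. -/
private theorem exists_bound (V : LogArg a b) : ∃ M, ∀ t ∈ Icc (a : ℝ) b, V.v t ≤ M := by
  obtain ⟨C, hC⟩ := isCompact_Icc.exists_bound_of_continuousOn V.cont
  exact ⟨C, fun t ht => (le_abs_self _).trans (by simpa using hC t ht)⟩

/-- Restriction of a logarithmic argument to a subinterval. -/
def restr (V : LogArg a b) (a' b' : ℚ) (h : (a : ℝ) ≤ a' ∧ (b' : ℝ) ≤ b) : LogArg a' b' where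
  v := V.v
  sa := V.sa.mono (fun _ hy => ⟨h.1.trans hy.1, hy.2.trans h.2⟩) (isSemialgebraic_ivl a' b')
  one_le t ht := V.one_le t ⟨h.1.trans ht.1, ht.2.trans h.2⟩
  cont := V.cont.mono (Icc_subset_Icc h.1 h.2)

/-- `restr_v`: auxiliary theorem of the lens-6 development «eis» (instances of 28994/4280) — see the module docstring; verbatim from the lens file. -/
@[simp] private theorem restr_v (V : LogArg a b) (a' b' : ℚ) (h) : (V.restr a' b' h).v = V.v := rfl

end LogArg

/-- The band `{(t, s) : a ≤ t ≤ b, 1 ≤ s ≤ v(t)}` over the interval. -/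
def bandOf (a b : ℚ) (V : LogArg a b) : Set (Fin 2 → ℝ) :=
  KZlog.band (ivl a b) (fun _ => 1) (fun y => V.v (y 0))

/-- `mem_bandOf`: auxiliary theorem of the lens-6 development «eis» (instances of 28994/4280) — see the module docstring; verbatim from the lens file. -/
private theorem mem_bandOf {a b : ℚ} {V : LogArg a b} {z : Fin 2 → ℝ} :
    z ∈ bandOf a b V ↔ ((a : ℝ) ≤ z 0 ∧ z 0 ≤ b) ∧ 1 ≤ z 1 ∧ z 1 ≤ V.v (z 0) := Iff.rfl

/-- `isSemialgebraic_bandOf`: auxiliary theorem of the lens-6 development «eis» (instances of 28994/4280) — see the module docstring; verbatim from the lens file. -/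
private theorem isSemialgebraic_bandOf (a b : ℚ) (V : LogArg a b) : IsSemialgebraic ℚ (bandOf a b V) :=
  KZlog.isSemialgebraic_band (by simpa using isSemialgebraicFunOn_ratCast (isSemialgebraic_ivl a b) 1)
    V.sa

/-- `bandOf_subset_Icc`: auxiliary theorem of the lens-6 development «eis» (instances of 28994/4280) — see the module docstring; verbatim from the lens file. -/
theorem bandOf_subset_Icc {a b : ℚ} (V : LogArg a b) {M : ℝ} (hM : ∀ t ∈ Icc (a : ℝ) b, V.v t ≤ M) :
    bandOf a b V ⊆ Icc ![(a : ℝ), 1] ![(b : ℝ), M] := by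
  intro z hz
  rcases mem_bandOf.1 hz with ⟨⟨h1, h2⟩, h3, h4⟩
  refine ⟨fun i => ?_, fun i => ?_⟩ <;> fin_cases i
  · simpa using h1
  · simpa using h3
  · simpa using h2
  · simpa using h4.trans (hM _ ⟨h1, h2⟩)

/-- `volume_bandOf_lt_top`: auxiliary theorem of the lens-6 development «eis» (instances of 28994/4280) — see the module docstring; verbatim from the lens file. -/
private theorem volume_bandOf_lt_top (a b : ℚ) (V : LogArg a b) : volume (bandOf a b V) < ⊤ := by
  obtain ⟨M, hM⟩ := V.exists_bound
  exact (measure_mono (bandOf_subset_Icc V hM)).trans_lt measure_Icc_lt_top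

/-- **`U(a,b,c,V) = [ {a ≤ t ≤ b, 1 ≤ s ≤ V(t)}, (c/q(t)) · ds dt / s ]`**, the unfolded form of the
one-dimensional logarithmic term `∫_a^b (c/q(t)) log V(t) dt`. -/
def U (a b c : ℚ) (V : LogArg a b) : KZ.IntegralRep 2 where
  domain := bandOf a b V
  integrand z := (c : ℝ) / qf (z 0) / z 1
  isSemialgebraic_domain := isSemialgebraic_bandOf a b V
  isSemialgebraicFunOn_integrand := by
    refine (isSemialgebraicFunOn_aeval_div_aeval (isSemialgebraic_bandOf a b V) (C c)
      ((1 - X 0 + X 0 ^ 2) * X 1) fun z hz => ?_).congr fun z _ => ?_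
    · have h1 := qf_pos (z 0)
      have h2 : (1 : ℝ) ≤ z 1 := (mem_bandOf.1 hz).2.1
      simp only [map_mul, map_add, map_sub, map_one, map_pow, aeval_X, qf] at h1 ⊢
      positivity
    · simp [qf, div_div]
  integrableOn := by
    have hB := isSemialgebraic_bandOf a b V
    refine Measure.integrableOn_of_bounded (volume_bandOf_lt_top a b V).ne
      (Measurable.aestronglyMeasurable (by unfold qf; fun_prop)) (M := 4 * |(c : ℝ)| / 3) ?_
    refine (ae_restrict_iff' (IsSemialgebraic.measurableSet_holds hB)).2 (ae_of_all _ fun z hz => ?_)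
    have h1 := qf_ge (z 0)
    have h0 := qf_pos (z 0)
    have h2 : (1 : ℝ) ≤ z 1 := (mem_bandOf.1 hz).2.1
    rw [Real.norm_eq_abs, abs_div, abs_div, abs_of_pos h0, abs_of_pos (show (0 : ℝ) < z 1 by linarith)]
    calc |(c : ℝ)| / qf (z 0) / z 1 ≤ |(c : ℝ)| / qf (z 0) := div_le_self (by positivity) h2
      _ ≤ |(c : ℝ)| / (3 / 4) := div_le_div_of_nonneg_left (abs_nonneg _) (by norm_num) h1
      _ = 4 * |(c : ℝ)| / 3 := by ring

/-- `U_domain`: auxiliary theorem of the lens-6 development «eis» (instances of 28994/4280) — see the module docstring; verbatim from the lens file. -/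
@[simp] private theorem U_domain (a b c : ℚ) (V : LogArg a b) : (U a b c V).domain = bandOf a b V := rfl
/-- `U_integrand`: auxiliary theorem of the lens-6 development «eis» (instances of 28994/4280) — see the module docstring; verbatim from the lens file. -/
@[simp] theorem U_integrand (a b c : ℚ) (V : LogArg a b) (z : Fin 2 → ℝ) :
    (U a b c V).integrand z = (c : ℝ) / qf (z 0) / z 1 := rfl

/-! ## Generic moves on the representations `U` -/

/-- **Halving the coefficient** (rule 1b). -/
private theorem rel_half (a b c : ℚ) (V : LogArg a b) :
    KZ.of (U a b c V) - KZ.of (U a b (c / 2) V) - KZ.of (U a b (c / 2) V) ∈ KZ.relations :=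
  KZ.integrandAddRel_subset_relations ⟨2, U a b c V, U a b (c / 2) V, U a b (c / 2) V, rfl, rfl,
    fun z _ => by simp only [U_integrand, Pi.add_apply, Rat.cast_div, Rat.cast_ofNat]; ring, rfl⟩

/-- `rel_two_half`: auxiliary theorem of the lens-6 development «eis» (instances of 28994/4280) — see the module docstring; verbatim from the lens file. -/
theorem rel_two_half (a b c : ℚ) (V : LogArg a b) :
    KZ.of (U a b c V) - 2 • KZ.of (U a b (c / 2) V) ∈ KZ.relations := by
  have := rel_half a b c V; rwa [sub_sub, ← two_nsmul] at this

/-- **Cutting the interval** at an interior rational point (rule 1a; the two bands meet in the null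
fibre `{t = m}`). -/
theorem rel_cut (a m b c : ℚ) (V : LogArg a b) (ham : a ≤ m) (hmb : m ≤ b) :
    KZ.of (U a b c V) - KZ.of (U a m c (V.restr a m ⟨le_rfl, by exact_mod_cast hmb⟩)) -
      KZ.of (U m b c (V.restr m b ⟨by exact_mod_cast ham, le_rfl⟩)) ∈ KZ.relations := by
  refine KZ.domainAddRel_subset_relations ⟨2, U a b c V, U a m c (V.restr a m ⟨le_rfl, by exact_mod_cast hmb⟩),
    U m b c (V.restr m b ⟨by exact_mod_cast ham, le_rfl⟩), ?_, ?_, fun z _ => rfl, fun z _ => rfl, rfl⟩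
  · ext z
    simp only [U_domain, mem_union, mem_bandOf, LogArg.restr_v]
    have hm1 : ((m : ℚ) : ℝ) ≤ b := by exact_mod_cast hmb
    have hm2 : ((a : ℚ) : ℝ) ≤ m := by exact_mod_cast ham
    constructor
    · rintro ⟨⟨h1, h2⟩, h3⟩
      rcases le_total (z 0) (m : ℝ) with h | h
      · exact Or.inl ⟨⟨h1, h⟩, h3⟩
      · exact Or.inr ⟨⟨h, h2⟩, h3⟩
    · rintro (⟨⟨h1, h2⟩, h3⟩ | ⟨⟨h1, h2⟩, h3⟩)
      · exact ⟨⟨h1, h2.trans hm1⟩, h3⟩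
      · exact ⟨⟨hm2.trans h1, h2⟩, h3⟩
  · refine measure_mono_null (fun z hz => ?_)
      (KZ.volume_setOf_init_mem_eq_zero (n := 1) (KZ.volume_setOf_last_eq_zero (n := 0) (m : ℝ)))
    simp only [U_domain, mem_inter_iff, mem_bandOf, LogArg.restr_v] at hz
    show Fin.init z (Fin.last 0) = (m : ℝ)
    exact le_antisymm (by simpa using hz.1.1.2) (by simpa using hz.2.1.1)

/-- **Product rule** `log(VW) = log V + log W` (Fubini + affine change of variables + additivity,
`KZ.of_sub_of_sub_mem_relations_mul`). -/
theorem rel_mul (a b c : ℚ) (V W VW : LogArg a b) (hVW : ∀ t ∈ Icc (a : ℝ) b, VW.v t = V.v t * W.v t) :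
    KZ.of (U a b c VW) - KZ.of (U a b c V) - KZ.of (U a b c W) ∈ KZ.relations := by
  have hσ := isSemialgebraic_ivl a b
  refine KZ.of_sub_of_sub_mem_relations_mul (σ := ivl a b) (u := fun y => V.v (y 0))
    (w := fun y => W.v (y 0)) (g := fun y => (c : ℝ) / qf (y 0)) hσ V.sa W.sa
    (fun y hy => V.one_le _ hy) (fun y hy => W.one_le _ hy)
    (U a b c VW) (U a b c V) (U a b c W) ?_ (fun z _ => rfl) rfl (fun z _ => rfl) rfl (fun z _ => rfl)
  simp only [U_domain, bandOf]
  exact KZlog.band_congr fun y hy => hVW (y 0) hy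

/-- Same, with `V = W`: `U(c, V²) ≡ 2 U(c, V)`. -/
theorem rel_sq (a b c : ℚ) (V VV : LogArg a b) (hVV : ∀ t ∈ Icc (a : ℝ) b, VV.v t = V.v t * V.v t) :
    KZ.of (U a b c VV) - 2 • KZ.of (U a b c V) ∈ KZ.relations := by
  have := rel_mul a b c V V VV hVV; rwa [sub_sub, ← two_nsmul] at this

/-- Two `U`'s on the same interval whose arguments agree on it are congruent. -/
private theorem rel_congr (a b c : ℚ) (V W : LogArg a b) (h : ∀ t ∈ Icc (a : ℝ) b, V.v t = W.v t) :
    KZ.of (U a b c V) - KZ.of (U a b c W) ∈ KZ.relations :=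
  KZ.of_sub_of_mem_relations_of_eqOn (by
    simp only [U_domain, bandOf]; exact KZlog.band_congr fun y hy => (h (y 0) hy).symm) fun z _ => rfl

/-- **One-variable substitution `t = κ(t')` in the base of the band** (rule 2, via
`KZ.of_sub_of_mem_relations_covLift`): if `κ : [a,b] → [a',b']` is a rational bijection with
`V = V' ∘ κ` and `c/q = (c'/q ∘ κ)·|κ'|` on `[a,b]`, then `U(a,b,c,V) ≡ U(a',b',c',V')`. -/
theorem rel_subst {a b a' b' c c' : ℚ} (V : LogArg a b) (V' : LogArg a' b') (κ κd : ℝ → ℝ)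
    (pn pd : MvPolynomial (Fin 1) ℚ) (hpd : ∀ y ∈ ivl a b, aeval y pd ≠ 0)
    (hκp : ∀ y ∈ ivl a b, aeval y pn / aeval y pd = κ (y 0))
    (hκd : ∀ t ∈ Icc (a : ℝ) b, HasDerivAt κ (κd t) t)
    (hinj : InjOn κ (Icc (a : ℝ) b)) (himg : κ '' Icc (a : ℝ) b = Icc (a' : ℝ) b')
    (hv : ∀ t ∈ Icc (a : ℝ) b, V.v t = V'.v (κ t))
    (hh : ∀ t ∈ Icc (a : ℝ) b, (c : ℝ) / qf t = (c' : ℝ) / qf (κ t) * |κd t|) :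
    KZ.of (U a b c V) - KZ.of (U a' b' c' V') ∈ KZ.relations := by
  have hσ := isSemialgebraic_ivl a b
  let Φ : (Fin 1 → ℝ) → (Fin 1 → ℝ) := fun y _ => κ (y 0)
  let Φ' : (Fin 1 → ℝ) → (Fin 1 → ℝ) →L[ℝ] (Fin 1 → ℝ) := fun y =>
    κd (y 0) • ContinuousLinearMap.id ℝ (Fin 1 → ℝ)
  have hdet : ∀ y, (Φ' y).det = κd (y 0) := fun y => by
    simp only [Φ', ContinuousLinearMap.det, ContinuousLinearMap.toLinearMap_smul, ContinuousLinearMap.coe_id,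
      LinearMap.det_smul, LinearMap.det_id, Module.finrank_fin_fun, pow_one, mul_one]
  have himage : Φ '' ivl a b = ivl a' b' := by
    ext w
    constructor
    · rintro ⟨y, hy, rfl⟩
      have : κ (y 0) ∈ Icc (a' : ℝ) b' := himg ▸ mem_image_of_mem κ hy
      exact this
    · intro hw
      obtain ⟨t, ht, htw⟩ : w 0 ∈ κ '' Icc (a : ℝ) b := himg ▸ hw
      refine ⟨fun _ => t, ht, ?_⟩
      rw [fin1_eq w]
      exact funext fun _ => htw
  refine KZ.of_sub_of_mem_relations_covLift (σ := ivl a b) (Φ := Φ) (Φ' := Φ')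
    (v := fun y => V.v (y 0)) (v' := fun y => V'.v (y 0)) ?_ ?_ ?_ (fun y hy => hv _ hy)
    (U a b c V) (U a' b' c' V') rfl (by rw [himage]; rfl) fun z hz => ?_
  · exact (isSemialgebraicMapOn_iff_forall_holds hσ).mpr fun _ =>
      (isSemialgebraicFunOn_aeval_div_aeval hσ pn pd hpd).congr fun y hy => hκp y hy
  · intro y hy
    have h1 : HasFDerivAt (fun y : Fin 1 → ℝ => κ (y 0))
        (κd (y 0) • ContinuousLinearMap.proj (R := ℝ) (φ := fun _ : Fin 1 => ℝ) 0) y :=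
      (hκd _ hy).comp_hasFDerivAt y (hasFDerivAt_apply 0 y)
    have h2 : HasFDerivAt Φ (ContinuousLinearMap.pi fun _ : Fin 1 =>
        κd (y 0) • ContinuousLinearMap.proj (R := ℝ) (φ := fun _ : Fin 1 => ℝ) 0) y :=
      hasFDerivAt_pi.2 fun _ => h1
    have h3 : (ContinuousLinearMap.pi fun _ : Fin 1 =>
        κd (y 0) • ContinuousLinearMap.proj (R := ℝ) (φ := fun _ : Fin 1 => ℝ) 0) = Φ' y := by
      ext w i
      rw [Fin.fin_one_eq_zero i]
      simp [Φ']
    exact (h3 ▸ h2).hasFDerivWithinAt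
  · intro y₁ hy₁ y₂ hy₂ h
    have h0 : κ (y₁ 0) = κ (y₂ 0) := congrFun h 0
    rw [fin1_eq y₁, fin1_eq y₂, hinj hy₁ hy₂ h0]
  · have hz0 : z 0 ∈ Icc (a : ℝ) b := (mem_bandOf.1 hz).1
    rw [hdet]
    change (c : ℝ) / qf (z 0) / z 1 = (c' : ℝ) / qf (κ (z 0)) / z 1 * |κd (z 0)|
    rw [hh _ hz0]; ring

/-- `rel_cut` with the two pieces given by arbitrary (pointwise equal) arguments. -/
theorem rel_cut' (a m b c : ℚ) (V : LogArg a b) (V₁ : LogArg a m) (V₂ : LogArg m b) (ham : a ≤ m)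
    (hmb : m ≤ b) (h₁ : ∀ t ∈ Icc (a : ℝ) m, V₁.v t = V.v t) (h₂ : ∀ t ∈ Icc (m : ℝ) b, V₂.v t = V.v t) :
    KZ.of (U a b c V) - KZ.of (U a m c V₁) - KZ.of (U m b c V₂) ∈ KZ.relations := by
  have h0 := rel_cut a m b c V ham hmb
  have e1 := rel_congr a m c (V.restr a m ⟨le_rfl, by exact_mod_cast hmb⟩) V₁ fun t ht => (h₁ t ht).symm
  have e2 := rel_congr m b c (V.restr m b ⟨by exact_mod_cast ham, le_rfl⟩) V₂ fun t ht => (h₂ t ht).symm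
  have : KZ.of (U a b c V) - KZ.of (U a m c V₁) - KZ.of (U m b c V₂) =
      (KZ.of (U a b c V) - KZ.of (U a m c (V.restr a m ⟨le_rfl, by exact_mod_cast hmb⟩)) -
        KZ.of (U m b c (V.restr m b ⟨by exact_mod_cast ham, le_rfl⟩))) +
      (KZ.of (U a m c (V.restr a m ⟨le_rfl, by exact_mod_cast hmb⟩)) - KZ.of (U a m c V₁)) +
      (KZ.of (U m b c (V.restr m b ⟨by exact_mod_cast ham, le_rfl⟩)) - KZ.of (U m b c V₂)) := by abel
  rw [this]
  exact KZ.relations.add_mem (KZ.relations.add_mem h0 e1) e2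

/-- Transitivity of congruence modulo `KZ.relations`. -/
private theorem rel_trans {x y z : KZ.FormalRep} (h₁ : x - y ∈ KZ.relations) (h₂ : y - z ∈ KZ.relations) :
    x - z ∈ KZ.relations := by
  have := KZ.relations.add_mem h₁ h₂; rwa [sub_add_sub_cancel] at this

/-! ## Calculus helpers for the rational substitutions -/

end Summit.KontsevichZagierPeriods.RootDecompQuadraticDescent.EisensteinPair

end
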